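import Literature.Analysis.FluidPDE.NSH1BoundedSmoothing
import Literature.Analysis.FluidPDE.TaoBoundedEnstrophyContinuation
import HarnessLib

/-!
# Tao (2011/2013), Cor. 11.1 and Cor. 11.4 for `H¹` data from a local `H¹` theory *without
# smoothing clause* (Leray's `leray_local_strong_H1`) and the nonlinear estimate of §10

`TaoBoundedEnstrophyContinuation.lean` derives Tao's Cor. 11.1 (`tao2011_boundedEnstrophy`,
bounded enstrophy of finite energy classical solutions on the closed slab from `H¹` data) — and
with it every vendored form of the unconditional uniqueness Cor. 11.4
(`tao_unconditional_uniqueness`, `…_velocity`, `…_velocity_unit`) — from the nonlinear estimate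
`Y₆` of §10 (`tao2011_nonlinearEstimate`, through `TaoAnnulusAssembly`) and Tao's local `H¹`
theory **with its smoothing clause** (`tao2011_H1_local_almost_regular`: Thm. 5.4 (i)–(ii) *and*
Prop. 5.6, the representation of the local Leray–Hopf solution by a strong classical solution on
every `[τ, T']`, `τ > 0`). The smoothing clause is what makes the restarted segments *strong away
from zero*, so that the strong-class speed bound and the FGT dissipation estimate apply.

This file removes the smoothing clause from that trust base. By `NSH1BoundedSmoothing.lean` an
**`H¹`-bounded** finite energy classical solution (`sup_t ∫‖D¹u(t)‖² < ∞`) already has all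
Sobolev norms bounded on `[ε, T]` for every `ε > 0`
(`IsClassicalNSSolutionOn.hasBoundedSobolevNormsOn_of_h1Bounded`, proved by the level-zero
vorticity energy method and restarts of the persistence step) and lies in `X¹`
(`IsClassicalNSSolutionOn.memSobolevX_of_h1Bounded`). Hence the restart induction can be run in
the class "`H¹`-bounded on `[0, s]`", and the restart step only needs a local Leray–Hopf solution
from `H¹` data that is `H¹`-continuous on the closed interval — the common, smoothing-free
consequence of Robinson–Rodrigo–Sadowski's Thm. 6.15 (`leray_local_strong_H1`,
`LerayH1Continuation.lean`, lifespan `cν³‖∇u₀‖⁻⁴`) and of Tao's Thm. 5.4 (i)–(ii)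
(`TaoH1AlmostRegularWith.exists_isH1RegularOn`, lifespan `cν³‖u₀‖⁻⁴_{H¹}`). Main results:

* `tao2011_boundedEnstrophy_of_localH1_of_apriori` — Cor. 11.1 from any local `H¹` theory of this
  smoothing-free shape (hypothesis written out) and the a priori Thm. 10.1;
* `tao2011_boundedEnstrophy_of_lerayLocalStrongH1_of_nonlinearEstimate :
    leray_local_strong_H1 → tao2011_nonlinearEstimate → tao2011_boundedEnstrophy`;
* `tao_unconditional_uniqueness_velocity_unit_of_lerayLocalStrongH1_of_nonlinearEstimate :
    leray_local_strong_H1 → tao2011_nonlinearEstimate → tao_unconditional_uniqueness_velocity_unit`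
  (and Cor. 11.4 as printed / velocity form, Cor. 11.1 at unit viscosity);
* applied to `TaoH1AlmostRegularWith.exists_isH1RegularOn` the first theorem recovers
  `tao2011_boundedEnstrophy_of_almostRegular_of_apriori` of `TaoBoundedEnstrophyContinuation`
  (not restated here).

## The argument

1. *Speed and uniform `H¹` bound on `H¹`-bounded initial segments*
   (`tao2011_boundedTotalSpeed_of_h1Bounded`, `exists_uniform_gradient_bound_h1`): the tree's
   `lintegral_eLpNorm_top_le_of_forall_hasBoundedSobolevNormsOn` and
   `exists_uniform_gradient_bound_of_forall` (`TaoBoundedEnstrophyContinuation`) ask for strongness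
   on every `[ε, T']`, which `hasBoundedSobolevNormsOn_of_h1Bounded` supplies.
2. *Restart* (`isH1RegularOn_restart`, `h1Bounded_restart`; Robinson–Rodrigo–Sadowski 2016, proof
   of Lemma 6.11, the classical-solution form of `LerayH1Continuation.isH1RegularOn_Icc_step`,
   allowing `s = 0`): `u(· + s)` is Leray–Hopf from `u(s)`
   (`isLerayHopfOn_translate_of_finiteEnergy`), the local solution `v` from `u(s)` is in the
   Serrin class `L^∞_t L⁶_x` (`memLqLp_top_six_of_isH1RegularOn_Icc`), Prodi–Serrin
   (`serrin_weak_strong_uniqueness_holds`) gives `u(t + s) = v(t)` a.e., a.e.-equal slices have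
   the same `H¹` norm, the `H¹`-regular piece is bounded by compactness, and
   `∫‖D¹u(t)‖² ≤ ‖u(t)‖²_{H¹}` for smooth slices: `u` is `H¹`-bounded on `[0, min(s + τ, T)]`,
   `τ = cν³/(A² + 1)`.
3. *Induction* with the uniform budget `A = sup∫|u|² + 3H + 3∫‖D¹u(0)‖²` as in
   `TaoLocalisationContinuation`; finally `memSobolevX_of_h1Bounded`.

No definition is introduced (the smoothing-free local theory is a written-out hypothesis).

## Mathlib / tree search

`lean search 'of_almostRegular|LerayLocalStrongH1With|isH1RegularOn_Icc_step'`: the tree has the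
`H¹`-data continuation with the smoothing clause (`TaoBoundedEnstrophyContinuation`) and the
Leray–Hopf `H¹`-regularity step from `leray_local_strong_H1` (`LerayH1Continuation`, `s > 0`
only, no enstrophy conclusion); nothing derived Cor. 11.1 from `leray_local_strong_H1`. Reused:
`exists_uniform_gradient_bound_of_forall`, `lintegral_eLpNorm_top_le_of_forall_hasBoundedSobolevNormsOn`
(`TaoBoundedEnstrophyContinuation`); `hasBoundedSobolevNormsOn_of_h1Bounded`,
`memSobolevX_of_h1Bounded` (`NSH1BoundedSmoothing`); `memLqLp_top_six_of_isH1RegularOn_Icc`,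
`eH1NormSq_congr_ae`, `LerayLocalStrongH1With` (`LerayH1Continuation`);
`TaoH1AlmostRegularWith.exists_isH1RegularOn` (`TaoH1AlmostRegular`); `IsH1RegularOn.exists_forall_le`,
`eH1NormSq_le_of_hasWeakGradient`, `eWeakGradL2Sq_eq_of_hasWeakGradient`
(`CheskidovShvydkoyRegular`); `isLerayHopfOn_translate_of_finiteEnergy`,
`memLp_two_of_lintegral_lt_top` (`TaoFiniteEnergyLerayHopf`); `serrin_weak_strong_uniqueness_holds`;
`lintegral_frobeniusNormSq_le_three_mul_iteratedFDeriv_one` (`TaoLocalisationContinuation`);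
`enorm_iteratedFDeriv_one`, `sq_opNorm_le_frobeniusNormSq`, `hasWeakGradient_fderiv_of_contDiff`;
the assemblies of `TaoAnnulusAssembly`, `TaoUnitViscosity`, `NSVelocityUniqueness`. Mathlib:
`exists_nat_ge`, `div_le_iff₀`.

## References

* T. Tao, *Localisation and compactness properties of the Navier–Stokes global regularity
  problem*, Anal. PDE 6 (2013) 25–107 = arXiv:1108.1165 (`Tao2011`): Cor. 11.1 and Remark 11.2
  (arXiv Cor. 68, Rem. 69, p. 36), Cor. 11.4 and Remark 11.3 (arXiv Cor. 71, p. 36), Thm. 10.1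
  and Remark 10.6 (arXiv Thm. 59, Rem. 64, pp. 30–33), Thm. 5.4 (arXiv Thm. 31, p. 18),
  footnote 3 (viscosity normalisation).
* J. C. Robinson, J. L. Rodrigo, W. Sadowski, *The Three-Dimensional Navier–Stokes Equations*,
  CUP 2016 (`RobinsonRodrigoSadowski2016`): Thm. 6.15 (local strong `H¹` solutions), proof of
  Lemma 6.11 (restart + weak–strong uniqueness), Thm. 8.19.
* J. Leray, Acta Math. 63 (1934) (`Leray1934`), §§19–22.
-/

noncomputable section

open MeasureTheory Set Function Filter Topology
open scoped ENNReal NNReal ContDiff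

namespace Literature.Analysis.FluidPDE

/-! ## Step 1: speed and uniform `H¹` bound on `H¹`-bounded initial segments -/

/-- **Bounded total speed on `H¹`-bounded segments** (the conclusion of Tao 2011, Prop. 9.1 =
arXiv Prop. 52, for `H¹`-bounded classical solutions). There is an absolute constant `K > 0` such
that for every `ν > 0`, `T > 0` and every classical solution `u` of the unforced Navier–Stokes
system on the closed slab `[0, T] × ℝ³` with `sup_t ∫|u(t)|² < ∞`, `sup_t ∫‖D¹u(t)‖² < ∞` and
energy dissipation `ν∫₀ᵀ∫|∇u|² ≤ E` (`E > 0`):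
`∫₀ᵀ ‖u(t)‖_{L^∞} dt ≤ K (ν^{-3/4} E^{1/2} T^{1/4} + ν⁻² E)`: such a solution has all Sobolev norms
bounded on every `[ε, T]` (`IsClassicalNSSolutionOn.hasBoundedSobolevNormsOn_of_h1Bounded`), so
the strong-away-from-zero bound `lintegral_eLpNorm_top_le_of_forall_hasBoundedSobolevNormsOn`
(Foias–Guillopé–Temam / Agmon) applies. [cite: RobinsonRodrigoSadowski2016, Lemma 8.15 + Thm. 8.17; Tao2011, Prop. 9.1 (statement)] -/
theorem tao2011_boundedTotalSpeed_of_h1Bounded :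
    ∃ K : ℝ, 0 < K ∧
      ∀ ⦃ν : ℝ⦄ (_hν : 0 < ν) ⦃T : ℝ⦄ (_hT : 0 < T)
        ⦃u : ℝ → EuclideanSpace ℝ (Fin 3) → EuclideanSpace ℝ (Fin 3)⦄
        ⦃p : ℝ → EuclideanSpace ℝ (Fin 3) → ℝ⦄
        (_hsol : IsClassicalNSSolutionOn (Icc 0 T) ν 0 u p)
        (_hE : ∃ C : ℝ≥0, ∀ t ∈ Icc 0 T, ∫⁻ x, ‖u t x‖ₑ ^ 2 ≤ C)
        (_hH : ∃ C : ℝ≥0, ∀ t ∈ Icc 0 T, ∫⁻ x, ‖iteratedFDeriv ℝ 1 (u t) x‖ₑ ^ 2 ≤ C)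
        ⦃E : ℝ⦄ (_hEpos : 0 < E)
        (_hD : ENNReal.ofReal ν *
            ∫⁻ t in Ioo 0 T, ∫⁻ x, ENNReal.ofReal (frobeniusNormSq (fderiv ℝ (u t) x)) ≤
          ENNReal.ofReal E),
        ∫⁻ t in Ioo 0 T, eLpNorm (u t) ∞ volume ≤
          ENNReal.ofReal (K * (ν ^ (-(3 / 4 : ℝ)) * Real.sqrt E * T ^ (1 / 4 : ℝ) + ν⁻¹ ^ 2 * E)) := by
  obtain ⟨K, hK, hspeed⟩ := lintegral_eLpNorm_top_le_of_forall_hasBoundedSobolevNormsOn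
  exact ⟨K, hK, fun ν hν T hT u p hsol hE hH E hEpos hD =>
    hspeed hν hT hsol (fun ε hε => hsol.hasBoundedSobolevNormsOn_of_h1Bounded hν hT hE hH hε.1 hε.2)
      hEpos hD⟩

/-- **Uniform gradient bound on `H¹`-bounded initial segments** (the rôle of Cor. 11.1 in the
continuation argument; `H¹`-bounded form of `exists_uniform_gradient_bound_of_forall`). Let
`(u, p)` be a finite energy classical solution on the closed slab `[0, T] × ℝ³` with
`∇u(0) ∈ L²`, and assume the a priori form of Tao's Thm. 10.1
(`tao2011_enstrophyLocalisation_exterior_apriori`). Then there is `H < ∞` such that for every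
`0 < T' ≤ T` with `sup_{t ≤ T'} ∫‖D¹u(t)‖² < ∞` one has `∫‖D¹u(t)‖² ≤ H` for all `t ∈ [0, T']`
(such a segment is strong on every `[ε, T']`, `hasBoundedSobolevNormsOn_of_h1Bounded`). [cite: Tao2011, Cor. 11.1 (proof) + Thm. 10.1 + Prop. 9.1] -/
theorem exists_uniform_gradient_bound_h1 (hA : tao2011_enstrophyLocalisation_exterior_apriori)
    {ν T : ℝ} (hν : 0 < ν) (hT : 0 < T)
    {u : ℝ → EuclideanSpace ℝ (Fin 3) → EuclideanSpace ℝ (Fin 3)}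
    {p : ℝ → EuclideanSpace ℝ (Fin 3) → ℝ}
    (hsol : IsClassicalNSSolutionOn (Icc 0 T) ν 0 u p)
    (hfe : ∃ C : ℝ≥0∞, C < ⊤ ∧ ∀ t ∈ Icc 0 T, ∫⁻ x, ‖u t x‖ₑ ^ 2 ≤ C)
    (h₁ : ∫⁻ x, ‖iteratedFDeriv ℝ 1 (u 0) x‖ₑ ^ 2 < ⊤) :
    ∃ H : ℝ≥0∞, H < ⊤ ∧ ∀ ⦃T' : ℝ⦄, 0 < T' → T' ≤ T →
      (∃ C : ℝ≥0, ∀ t ∈ Icc 0 T', ∫⁻ x, ‖iteratedFDeriv ℝ 1 (u t) x‖ₑ ^ 2 ≤ C) →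
      ∀ t ∈ Icc 0 T', ∫⁻ x, ‖iteratedFDeriv ℝ 1 (u t) x‖ₑ ^ 2 ≤ H := by
  obtain ⟨H, hHtop, hH⟩ := exists_uniform_gradient_bound_of_forall hA hν hT hsol hfe h₁
  refine ⟨H, hHtop, fun T' hT' hT'T hHB => hH hT' hT'T fun ε hε => ?_⟩
  have hsub : Icc 0 T' ⊆ Icc 0 T := Icc_subset_Icc_right hT'T
  have hsol' : IsClassicalNSSolutionOn (Icc 0 T') ν 0 u p := hsol.mono hsub (uniqueDiffOn_Icc hT')
  have hE' : ∃ C₀ : ℝ≥0, ∀ t ∈ Icc 0 T', ∫⁻ x, ‖u t x‖ₑ ^ 2 ≤ C₀ := by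
    obtain ⟨C₀, hC₀, hb⟩ := hfe
    exact ⟨C₀.toNNReal, fun t ht => (hb t (hsub ht)).trans_eq (ENNReal.coe_toNNReal hC₀.ne).symm⟩
  exact hsol'.hasBoundedSobolevNormsOn_of_h1Bounded hν hT' hE' hHB hε.1 hε.2

/-! ## Step 2: the restart (a local `H¹` solution + weak–strong uniqueness) -/

/-- **`H¹` norms of smooth slices.** For a `C¹` field `v`, `∫ ‖D¹v‖² ≤ ‖v‖²_{H¹}`:
`∫⁻ ‖D¹v‖ₑ² ≤ ∫⁻ |∇v|²_F = Fluid.eWeakGradL2Sq v ≤ Fluid.eH1NormSq v` (operator norm `≤` Frobenius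
norm; the classical gradient is the weak gradient). [folklore] -/
theorem lintegral_iteratedFDeriv_one_le_eH1NormSq
    {v : EuclideanSpace ℝ (Fin 3) → EuclideanSpace ℝ (Fin 3)} (hv : ContDiff ℝ 1 v) :
    ∫⁻ x, ‖iteratedFDeriv ℝ 1 v x‖ₑ ^ 2 ≤ FluidPDE.eH1NormSq v := by
  have h1 : ∫⁻ x, ‖iteratedFDeriv ℝ 1 v x‖ₑ ^ 2 ≤
      ∫⁻ x, ENNReal.ofReal (frobeniusNormSq (fderiv ℝ v x)) := by
    refine lintegral_mono fun x => ?_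
    rw [enorm_iteratedFDeriv_one, ← ofReal_norm, ← ENNReal.ofReal_pow (norm_nonneg _)]
    exact ENNReal.ofReal_le_ofReal (sq_opNorm_le_frobeniusNormSq _)
  rw [FluidPDE.eH1NormSq_def,
    FluidPDE.eWeakGradL2Sq_eq_of_hasWeakGradient (hasWeakGradient_fderiv_of_contDiff hv)]
  exact h1.trans le_add_self

/-- **The `H¹` budget of a smooth slice**: `‖v‖²_{H¹} ≤ ∫⁻‖v‖ₑ² + 3 ∫⁻‖D¹v‖ₑ²` for `C¹` fields
(the classical gradient is a weak gradient; Frobenius `≤ 3 ·` operator norm squared). [folklore] -/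
theorem eH1NormSq_le_of_contDiff
    {v : EuclideanSpace ℝ (Fin 3) → EuclideanSpace ℝ (Fin 3)} (hv : ContDiff ℝ 1 v) :
    FluidPDE.eH1NormSq v ≤ (∫⁻ x, ‖v x‖ₑ ^ 2) + 3 * ∫⁻ x, ‖iteratedFDeriv ℝ 1 v x‖ₑ ^ 2 := by
  refine (FluidPDE.eH1NormSq_le_of_hasWeakGradient (hasWeakGradient_fderiv_of_contDiff hv)).trans ?_
  exact add_le_add le_rfl (lintegral_frobeniusNormSq_le_three_mul_iteratedFDeriv_one v)

/-- Leray's local `H¹` theory with lifespan by `‖∇u₀‖` (`LerayLocalStrongH1With c`,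
Robinson–Rodrigo–Sadowski 2016, Thm. 6.15) implies the smoothing-free local `H¹` theory with
lifespan by the full `H¹` norm used below (`‖∇u₀‖² ≤ ‖u₀‖²_{H¹}`). [cite: RobinsonRodrigoSadowski2016, Thm. 6.15] -/
theorem LerayLocalStrongH1With.exists_isH1RegularOn {c : ℝ} (h : LerayLocalStrongH1With c)
    ⦃ν T : ℝ⦄ (hν : 0 < ν) (hT : 0 < T)
    ⦃u₀ : EuclideanSpace ℝ (Fin 3) → EuclideanSpace ℝ (Fin 3)⦄ (hu₀ : MemLp u₀ 2 volume)
    (hdiv : FluidPDE.IsWeaklyDivFree u₀) ⦃A : ℝ⦄ (hA : 0 ≤ A)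
    (hH1 : FluidPDE.eH1NormSq u₀ ≤ ENNReal.ofReal A) (hsmall : A ^ 2 * T ≤ c * ν ^ 3) :
    ∃ v : ℝ → EuclideanSpace ℝ (Fin 3) → EuclideanSpace ℝ (Fin 3),
      FluidPDE.IsLerayHopfOn T ν 0 u₀ v ∧ v 0 = u₀ ∧ FluidPDE.IsH1RegularOn (Icc 0 T) v :=
  h hν hT hu₀ hdiv hA (le_add_self.trans hH1) hsmall

/-- **Restart step for classical solutions** (Robinson–Rodrigo–Sadowski 2016, proof of
Lemma 6.11: "we can construct a strong solution `v` with initial condition `v(0) = u(t)` … Using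
weak–strong uniqueness `u(t+s) = v(s)`"; the classical-solution form of
`LerayH1Continuation.isH1RegularOn_Icc_step`, allowing `s = 0`). Let `(u, p)` be a finite energy
classical solution on `[0, T] × ℝ³` (`ν > 0`) and assume a local `H¹` theory with lifespan
constant `c` (smoothing-free shape: from `u₀ ∈ H¹` divergence free with `‖u₀‖²_{H¹} ≤ A`,
`A²T ≤ cν³`, a Leray–Hopf solution on `[0, T)` attaining `u₀`, `H¹`-continuous on `[0, T]`). If
`0 ≤ s < T`, `‖u(s)‖²_{H¹} ≤ A` and `A²τ ≤ cν³`, then `‖u(t)‖²_{H¹}` is finite and continuous on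
`[s, min(s + τ, T)]`: `u(· + s)` is a Leray–Hopf solution from `u(s)`
(`isLerayHopfOn_translate_of_finiteEnergy`), the local solution `v` from `u(s)` lies in the
Serrin class `L^∞_t L⁶_x` (`memLqLp_top_six_of_isH1RegularOn_Icc`), so `u(t + s) = v(t)` a.e. by
`serrin_weak_strong_uniqueness_holds`, and a.e.-equal slices have the same `H¹` norm. [cite: RobinsonRodrigoSadowski2016, Lemma 6.11 (proof)] -/
theorem isH1RegularOn_restart {c : ℝ}
    (hloc : ∀ ⦃ν T : ℝ⦄, 0 < ν → 0 < T →
      ∀ ⦃u₀ : EuclideanSpace ℝ (Fin 3) → EuclideanSpace ℝ (Fin 3)⦄, MemLp u₀ 2 volume →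
        FluidPDE.IsWeaklyDivFree u₀ → ∀ ⦃A : ℝ⦄, 0 ≤ A →
        FluidPDE.eH1NormSq u₀ ≤ ENNReal.ofReal A → A ^ 2 * T ≤ c * ν ^ 3 →
        ∃ v : ℝ → EuclideanSpace ℝ (Fin 3) → EuclideanSpace ℝ (Fin 3),
          FluidPDE.IsLerayHopfOn T ν 0 u₀ v ∧ v 0 = u₀ ∧ FluidPDE.IsH1RegularOn (Icc 0 T) v)
    {ν T : ℝ} (hν : 0 < ν)
    {u : ℝ → EuclideanSpace ℝ (Fin 3) → EuclideanSpace ℝ (Fin 3)}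
    {p : ℝ → EuclideanSpace ℝ (Fin 3) → ℝ}
    (hsol : IsClassicalNSSolutionOn (Icc 0 T) ν 0 u p)
    (hfe : ∃ C : ℝ≥0∞, C < ⊤ ∧ ∀ t ∈ Icc 0 T, ∫⁻ x, ‖u t x‖ₑ ^ 2 ≤ C)
    {s : ℝ} (hs0 : 0 ≤ s) (hsT : s < T) {A τ : ℝ} (hA : 0 ≤ A)
    (hAs : FluidPDE.eH1NormSq (u s) ≤ ENNReal.ofReal A) (hτ : 0 < τ) (hτc : A ^ 2 * τ ≤ c * ν ^ 3) :
    FluidPDE.IsH1RegularOn (Icc s (min (s + τ) T)) u := by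
  set τ' : ℝ := min τ (T - s) with hτ'def
  have hτ' : 0 < τ' := lt_min hτ (sub_pos.2 hsT)
  have hsI : s ∈ Icc 0 T := ⟨hs0, hsT.le⟩
  have hus : ContDiff ℝ ∞ (u s) := hsol.contDiff_velocity hsI
  have hu2 : MemLp (u s) 2 volume := by
    refine memLp_two_of_lintegral_lt_top hus.continuous ?_
    obtain ⟨C₀, hC₀, hb⟩ := hfe
    exact (hb s hsI).trans_lt hC₀
  -- the translate is a Leray–Hopf solution from `u(s)`
  have hLHs : FluidPDE.IsLerayHopfOn (T - s) ν 0 (u s) (fun t => u (t + s)) :=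
    (isLerayHopfOn_translate_of_finiteEnergy hsol hν hs0 hsT hfe).1
  have hdiv : FluidPDE.IsWeaklyDivFree (u s) := hLHs.isWeaklyDivFree_datum (sub_pos.2 hsT)
  have hτ'c : A ^ 2 * τ' ≤ c * ν ^ 3 :=
    (mul_le_mul_of_nonneg_left (min_le_left _ _) (sq_nonneg A)).trans hτc
  obtain ⟨v, hv, hv0, hvreg⟩ := hloc hν hτ' hu2 hdiv hA hAs hτ'c
  -- weak–strong uniqueness: `u(t + s) = v(t)` a.e., `0 < t ≤ τ'`
  have hLHs' : FluidPDE.IsLerayHopfOn τ' ν 0 (u s) (fun t => u (t + s)) :=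
    hLHs.of_le (min_le_right _ _)
  have hS : FluidPDE.MemLqLp ∞ 6 v (Ioo 0 τ') :=
    memLqLp_top_six_of_isH1RegularOn_Icc hvreg fun t ht => hv.memLp t ht
  have hqr : 2 / (∞ : ℝ≥0∞) + 3 / 6 ≤ 1 := by
    rw [ENNReal.div_top, zero_add]
    exact ENNReal.div_le_of_le_mul (by norm_num)
  have hae : ∀ t ∈ Ioc 0 τ', (fun t => u (t + s)) t =ᵐ[volume] v t :=
    serrin_weak_strong_uniqueness_holds hν hτ' hv hu2 (q := ∞) (r := 6) (by norm_num) hqr hS hLHs'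
  -- the `H¹` norms of `u` on `[s, s + τ']` are those of `v` on `[0, τ']`
  have heq : ∀ t ∈ Icc s (s + τ'), FluidPDE.eH1NormSq (u t) = FluidPDE.eH1NormSq (v (t - s)) := by
    intro t ht
    rcases eq_or_lt_of_le ht.1 with h | h
    · rw [← h, sub_self, hv0]
    · have h1 := hae (t - s) ⟨sub_pos.2 h, by linarith [ht.2]⟩
      simp only [sub_add_cancel] at h1
      exact FluidPDE.eH1NormSq_congr_ae h1
  have hmin : min (s + τ) T = s + τ' := by
    rw [hτ'def, ← min_add_add_left, add_sub_cancel]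
  have hmaps : MapsTo (fun t => t - s) (Icc s (s + τ')) (Icc 0 τ') := fun t ht =>
    ⟨sub_nonneg.2 ht.1, by linarith [ht.2]⟩
  rw [hmin]
  refine ⟨fun t ht => ?_, ?_⟩
  · rw [heq t ht]
    exact hvreg.1 (t - s) (hmaps ht)
  · have hcont : ContinuousOn (fun t => FluidPDE.eH1NormSq (v (t - s))) (Icc s (s + τ')) :=
      hvreg.2.comp (continuousOn_id.sub continuousOn_const) hmaps
    exact hcont.congr fun t ht => heq t ht

/-- **Restart in the `H¹`-bounded class.** With `τ = cν³/(A_b² + 1)` attached to a budget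
`A_b ≥ 0`: if `u` is `H¹`-bounded on `[0, s]` (`sup_{t ≤ s} ∫‖D¹u(t)‖² < ∞`, `0 ≤ s < T`) and
`‖u(s)‖²_{H¹} ≤ A_b`, then `u` is `H¹`-bounded on `[0, min(s + τ, T)]` (the `H¹`-regular piece
`[s, min(s + τ, T)]` of `isH1RegularOn_restart` has `‖u(t)‖²_{H¹}` bounded by compactness, and
`∫‖D¹u(t)‖² ≤ ‖u(t)‖²_{H¹}` for smooth slices). [cite: RobinsonRodrigoSadowski2016, Lemma 6.11 (proof)] -/
theorem h1Bounded_restart {c : ℝ} (hc : 0 < c)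
    (hloc : ∀ ⦃ν T : ℝ⦄, 0 < ν → 0 < T →
      ∀ ⦃u₀ : EuclideanSpace ℝ (Fin 3) → EuclideanSpace ℝ (Fin 3)⦄, MemLp u₀ 2 volume →
        FluidPDE.IsWeaklyDivFree u₀ → ∀ ⦃A : ℝ⦄, 0 ≤ A →
        FluidPDE.eH1NormSq u₀ ≤ ENNReal.ofReal A → A ^ 2 * T ≤ c * ν ^ 3 →
        ∃ v : ℝ → EuclideanSpace ℝ (Fin 3) → EuclideanSpace ℝ (Fin 3),
          FluidPDE.IsLerayHopfOn T ν 0 u₀ v ∧ v 0 = u₀ ∧ FluidPDE.IsH1RegularOn (Icc 0 T) v)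
    {ν T : ℝ} (hν : 0 < ν)
    {u : ℝ → EuclideanSpace ℝ (Fin 3) → EuclideanSpace ℝ (Fin 3)}
    {p : ℝ → EuclideanSpace ℝ (Fin 3) → ℝ}
    (hsol : IsClassicalNSSolutionOn (Icc 0 T) ν 0 u p)
    (hfe : ∃ C : ℝ≥0∞, C < ⊤ ∧ ∀ t ∈ Icc 0 T, ∫⁻ x, ‖u t x‖ₑ ^ 2 ≤ C) {Ab : ℝ} (hAb : 0 ≤ Ab) :
    ∃ τ : ℝ, 0 < τ ∧ ∀ ⦃s : ℝ⦄, 0 ≤ s → s < T →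
      (∃ C₁ : ℝ≥0, ∀ t ∈ Icc 0 s, ∫⁻ x, ‖iteratedFDeriv ℝ 1 (u t) x‖ₑ ^ 2 ≤ C₁) →
      FluidPDE.eH1NormSq (u s) ≤ ENNReal.ofReal Ab →
      ∃ C₁ : ℝ≥0, ∀ t ∈ Icc 0 (min (s + τ) T), ∫⁻ x, ‖iteratedFDeriv ℝ 1 (u t) x‖ₑ ^ 2 ≤ C₁ := by
  set τ : ℝ := c * ν ^ 3 / (Ab ^ 2 + 1) with hτ
  have hτpos : 0 < τ := by positivity
  have hτc : Ab ^ 2 * τ ≤ c * ν ^ 3 := by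
    rw [hτ, mul_div_assoc', div_le_iff₀ (by positivity)]
    nlinarith [sq_nonneg Ab, mul_pos hc (pow_pos hν 3)]
  refine ⟨τ, hτpos, fun s hs0 hsT hHB hAs => ?_⟩
  obtain ⟨C₁, hC₁⟩ := hHB
  have hreg := isH1RegularOn_restart hloc hν hsol hfe hs0 hsT hAb hAs hτpos hτc
  obtain ⟨M, hM, hbound⟩ := hreg.exists_forall_le isCompact_Icc subset_rfl
  refine ⟨max C₁ M.toNNReal, fun t ht => ?_⟩
  rcases le_or_gt t s with hts | hts
  · exact (hC₁ t ⟨ht.1, hts⟩).trans (ENNReal.coe_le_coe.2 (le_max_left _ _))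
  · have htI : t ∈ Icc 0 T := ⟨ht.1, ht.2.trans (min_le_right _ _)⟩
    have hv : ContDiff ℝ 1 (u t) := (hsol.contDiff_velocity htI).of_le (by norm_cast)
    calc ∫⁻ x, ‖iteratedFDeriv ℝ 1 (u t) x‖ₑ ^ 2 ≤ FluidPDE.eH1NormSq (u t) :=
          lintegral_iteratedFDeriv_one_le_eH1NormSq hv
      _ ≤ M := hbound t ⟨hts.le, ht.2⟩
      _ = (M.toNNReal : ℝ≥0∞) := (ENNReal.coe_toNNReal hM.ne).symm
      _ ≤ (max C₁ M.toNNReal : ℝ≥0) := ENNReal.coe_le_coe.2 (le_max_right _ _)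

/-! ## Step 3: the induction — Cor. 11.1 from a smoothing-free local `H¹` theory -/

/-- **Cor. 11.1 (`tao2011_boundedEnstrophy`) from a smoothing-free local `H¹` theory and the a
priori Thm. 10.1** (Tao 2011, Cor. 11.1 = arXiv Cor. 68, for classical solutions on the closed
slab; the printed input Prop. 9.1 is replaced, inside a restart induction in the `H¹`-bounded
class, by the strong-class speed bound, and no smoothing of the local solution is needed): with
the uniform gradient bound `H` of `exists_uniform_gradient_bound_h1` and the budget
`A_b = sup_t∫|u|² + 3H + 3∫‖D¹u(0)‖²`, every `H¹`-bounded initial segment `[0, s]` restarts with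
`‖u(s)‖²_{H¹} ≤ A_b` (`h1Bounded_restart`), so `H¹`-boundedness propagates from `[0, 0]` (the `H¹`
datum) to `[0, min(kτ, T)]` for every `k`, i.e. to `[0, T]`; an `H¹`-bounded finite energy
classical solution lies in `X¹` (`IsClassicalNSSolutionOn.memSobolevX_of_h1Bounded`). The local
theory enters through `hloc` (lifespan constant `c > 0`): from `u₀ ∈ L²` weakly divergence free
with `‖u₀‖²_{H¹} ≤ A`, `A²T' ≤ cν³`, a Leray–Hopf solution on `[0, T')` with `v 0 = u₀`,
`H¹`-continuous on `[0, T']` — implied by `leray_local_strong_H1` and by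
`tao2011_H1_local_almost_regular`. [cite: Tao2011, Cor. 11.1; RobinsonRodrigoSadowski2016, Lemma 6.11 (proof)] -/
theorem tao2011_boundedEnstrophy_of_localH1_of_apriori {c : ℝ} (hc : 0 < c)
    (hloc : ∀ ⦃ν T : ℝ⦄, 0 < ν → 0 < T →
      ∀ ⦃u₀ : EuclideanSpace ℝ (Fin 3) → EuclideanSpace ℝ (Fin 3)⦄, MemLp u₀ 2 volume →
        FluidPDE.IsWeaklyDivFree u₀ → ∀ ⦃A : ℝ⦄, 0 ≤ A →
        FluidPDE.eH1NormSq u₀ ≤ ENNReal.ofReal A → A ^ 2 * T ≤ c * ν ^ 3 →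
        ∃ v : ℝ → EuclideanSpace ℝ (Fin 3) → EuclideanSpace ℝ (Fin 3),
          FluidPDE.IsLerayHopfOn T ν 0 u₀ v ∧ v 0 = u₀ ∧ FluidPDE.IsH1RegularOn (Icc 0 T) v)
    (hA : tao2011_enstrophyLocalisation_exterior_apriori) : tao2011_boundedEnstrophy := by
  intro ν T hν hT u p hsol hE h₀
  obtain ⟨C, hC⟩ := hE
  have hfe : ∃ C : ℝ≥0∞, C < ⊤ ∧ ∀ t ∈ Icc 0 T, ∫⁻ x, ‖u t x‖ₑ ^ 2 ≤ C :=
    ⟨C, ENNReal.coe_lt_top, hC⟩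
  -- the uniform gradient bound on `H¹`-bounded initial segments
  obtain ⟨H, hHtop, hH⟩ := exists_uniform_gradient_bound_h1 hA hν hT hsol hfe h₀
  -- the `H¹` budget `Ab` at restart times
  set D₀ : ℝ≥0∞ := ∫⁻ x, ‖iteratedFDeriv ℝ 1 (u 0) x‖ₑ ^ 2 with hD₀def
  have h3H : 3 * H ≠ ⊤ := ENNReal.mul_ne_top (by simp) hHtop.ne
  have h3D : 3 * D₀ ≠ ⊤ := ENNReal.mul_ne_top (by simp) h₀.ne
  set Ab : ℝ := (C : ℝ) + (3 * H).toReal + (3 * D₀).toReal with hAbdef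
  have hAb : 0 ≤ Ab := by positivity
  have hbound : ∀ ⦃s : ℝ⦄, 0 ≤ s → s < T →
      (∃ C₁ : ℝ≥0, ∀ t ∈ Icc 0 s, ∫⁻ x, ‖iteratedFDeriv ℝ 1 (u t) x‖ₑ ^ 2 ≤ C₁) →
      FluidPDE.eH1NormSq (u s) ≤ ENNReal.ofReal Ab := by
    intro s hs0 hsT hHB
    have hsI : s ∈ Icc 0 T := ⟨hs0, hsT.le⟩
    have hv : ContDiff ℝ 1 (u s) := (hsol.contDiff_velocity hsI).of_le (by norm_cast)
    have hL2 : ∫⁻ x, ‖u s x‖ₑ ^ 2 ≤ (C : ℝ≥0∞) := hC s hsI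
    have hgrad : 3 * ∫⁻ x, ‖iteratedFDeriv ℝ 1 (u s) x‖ₑ ^ 2 ≤ 3 * H + 3 * D₀ := by
      rcases eq_or_lt_of_le hs0 with h0 | hs0'
      · rw [← h0]
        exact le_add_self
      · refine le_trans ?_ le_self_add
        exact mul_le_mul_right (hH hs0' hsT.le hHB s ⟨hs0, le_rfl⟩) 3
    calc FluidPDE.eH1NormSq (u s)
        ≤ (∫⁻ x, ‖u s x‖ₑ ^ 2) + 3 * ∫⁻ x, ‖iteratedFDeriv ℝ 1 (u s) x‖ₑ ^ 2 :=
          eH1NormSq_le_of_contDiff hv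
      _ ≤ (C : ℝ≥0∞) + (3 * H + 3 * D₀) := add_le_add hL2 hgrad
      _ = ENNReal.ofReal Ab := by
          rw [hAbdef, ENNReal.ofReal_add (by positivity) ENNReal.toReal_nonneg,
            ENNReal.ofReal_add (by positivity) ENNReal.toReal_nonneg, ENNReal.ofReal_coe_nnreal,
            ENNReal.ofReal_toReal h3H, ENNReal.ofReal_toReal h3D, add_assoc]
  -- the restart with uniform step `τ`
  obtain ⟨τ, hτ, hstep⟩ := h1Bounded_restart hc hloc hν hsol hfe hAb
  -- induction on the number of restarts
  have hind : ∀ k : ℕ, ∃ C₁ : ℝ≥0, ∀ t ∈ Icc 0 (min ((k : ℝ) * τ) T),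
      ∫⁻ x, ‖iteratedFDeriv ℝ 1 (u t) x‖ₑ ^ 2 ≤ C₁ := by
    intro k
    induction k with
    | zero =>
      refine ⟨D₀.toNNReal, fun t ht => ?_⟩
      rw [Nat.cast_zero, zero_mul, min_eq_left hT.le] at ht
      obtain rfl : t = 0 := le_antisymm ht.2 ht.1
      exact (ENNReal.coe_toNNReal h₀.ne).ge
    | succ k ih =>
      by_cases hkT : (k : ℝ) * τ < T
      · rw [min_eq_left hkT.le] at ih
        have hk0 : 0 ≤ (k : ℝ) * τ := by positivity
        obtain ⟨C₁, hC₁⟩ := hstep hk0 hkT ih (hbound hk0 hkT ih)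
        refine ⟨C₁, fun t ht => hC₁ t ⟨ht.1, ht.2.trans (le_of_eq ?_)⟩⟩
        push_cast
        ring_nf
      · have hkT' : T ≤ (k : ℝ) * τ := not_lt.1 hkT
        rw [min_eq_right hkT'] at ih
        have hk1 : T ≤ ((k + 1 : ℕ) : ℝ) * τ := by
          push_cast
          nlinarith
        rwa [min_eq_right hk1]
  obtain ⟨k, hk⟩ : ∃ k : ℕ, T ≤ (k : ℝ) * τ := by
    obtain ⟨k, hk⟩ := exists_nat_ge (T / τ)
    exact ⟨k, by rwa [div_le_iff₀ hτ] at hk⟩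
  obtain ⟨C₁, hC₁⟩ := hind k
  rw [min_eq_right hk] at hC₁
  exact hsol.memSobolevX_of_h1Bounded hν hT ⟨C, hC⟩ ⟨C₁, hC₁⟩

/-! ## Consequences: Cor. 11.1 and Cor. 11.4 from Leray's local `H¹` theory -/

/-- **Cor. 11.1 from Leray's local `H¹` theory (Robinson–Rodrigo–Sadowski 2016, Thm. 6.15) and
the a priori Thm. 10.1.** [cite: Tao2011, Cor. 11.1; RobinsonRodrigoSadowski2016, Thm. 6.15] -/
theorem tao2011_boundedEnstrophy_of_lerayLocalStrongH1_of_apriori (hLoc : leray_local_strong_H1)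
    (hA : tao2011_enstrophyLocalisation_exterior_apriori) : tao2011_boundedEnstrophy := by
  obtain ⟨c, hc, hloc⟩ := hLoc
  exact tao2011_boundedEnstrophy_of_localH1_of_apriori hc hloc.exists_isH1RegularOn hA

/-- **Cor. 11.1 (every `ν > 0`) from Leray's local `H¹` theory and the nonlinear estimate `Y₆`
of §10** (the annular a priori Thm. 10.1 being assembled from `Y₆` in `TaoAnnulusAssembly`, the
exterior form by monotone convergence in `TaoEnstrophyLocalisationAnnulus`, and the passage
`ν = 1 → ν > 0` by rescaling in `TaoUnitViscosity`). [cite: Tao2011, Cor. 11.1 + Thm. 10.1 (proof, §10); RobinsonRodrigoSadowski2016, Thm. 6.15] -/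
theorem tao2011_boundedEnstrophy_of_lerayLocalStrongH1_of_nonlinearEstimate
    (hLoc : leray_local_strong_H1) (hY : tao2011_nonlinearEstimate) : tao2011_boundedEnstrophy :=
  tao2011_boundedEnstrophy_of_lerayLocalStrongH1_of_apriori hLoc
    (tao2011_enstrophyLocalisation_exterior_apriori_of_unit
      (tao2011_enstrophyLocalisation_exterior_apriori_unit_of_nonlinearEstimate hY))

/-- **Cor. 11.1 at unit viscosity (as printed, `tao2011_boundedEnstrophy_unit`) from Leray's local
`H¹` theory and `Y₆`.** [cite: Tao2011, Cor. 11.1 + Thm. 10.1 (proof, §10); RobinsonRodrigoSadowski2016, Thm. 6.15] -/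
theorem tao2011_boundedEnstrophy_unit_of_lerayLocalStrongH1_of_nonlinearEstimate
    (hLoc : leray_local_strong_H1) (hY : tao2011_nonlinearEstimate) :
    tao2011_boundedEnstrophy_unit :=
  tao2011_boundedEnstrophy_iff_unit.1
    (tao2011_boundedEnstrophy_of_lerayLocalStrongH1_of_nonlinearEstimate hLoc hY)

/-- **Cor. 11.4 (unconditional uniqueness) as printed, its velocity form, and the duplicate
vendoring `tao_finite_energy_velocity_uniqueness`, from Leray's local `H¹` theory and `Y₆`** (the
`B`-side of Remark 11.3, Cor. 4.3 + Thm. 5.4 (iii), is the tree theorem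
`tao2011_velocity_eq_of_memSobolevX_holds`). [cite: Tao2011, Cor. 11.4 (Remark 11.3); RobinsonRodrigoSadowski2016, Thm. 6.15] -/
theorem tao_unconditional_uniqueness_of_lerayLocalStrongH1_of_nonlinearEstimate
    (hLoc : leray_local_strong_H1) (hY : tao2011_nonlinearEstimate) :
    tao_unconditional_uniqueness ∧ tao_unconditional_uniqueness_velocity ∧
      tao_finite_energy_velocity_uniqueness :=
  have hB := tao2011_boundedEnstrophy_of_lerayLocalStrongH1_of_nonlinearEstimate hLoc hY
  ⟨(tao_unconditional_uniqueness_of_boundedEnstrophy hB).1,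
    tao_unconditional_uniqueness_velocity_of_boundedEnstrophy hB,
    (tao_unconditional_uniqueness_of_boundedEnstrophy hB).2⟩

/-- **Cor. 11.4, velocity form at unit viscosity (`tao_unconditional_uniqueness_velocity_unit`),
from Leray's local `H¹` theory and `Y₆`** — the sharpest leaf set for this fact on the
continuation route: Robinson–Rodrigo–Sadowski's Thm. 6.15 (`leray_local_strong_H1`) and the
nonlinear estimate of §10 (`tao2011_nonlinearEstimate`); Prop. 9.1 and the smoothing theory of
mild solutions are not needed. [cite: Tao2011, Cor. 11.4 (Remark 11.3) + footnote 3; RobinsonRodrigoSadowski2016, Thm. 6.15] -/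
theorem tao_unconditional_uniqueness_velocity_unit_of_lerayLocalStrongH1_of_nonlinearEstimate
    (hLoc : leray_local_strong_H1) (hY : tao2011_nonlinearEstimate) :
    tao_unconditional_uniqueness_velocity_unit :=
  tao_unconditional_uniqueness_velocity_iff_unit.1
    (tao_unconditional_uniqueness_of_lerayLocalStrongH1_of_nonlinearEstimate hLoc hY).2.1

/-- The same with the a priori Thm. 10.1 (exterior form, `ν > 0`) as the second leaf. [cite: Tao2011, Cor. 11.4 (Remark 11.3) + footnote 3; RobinsonRodrigoSadowski2016, Thm. 6.15] -/
theorem tao_unconditional_uniqueness_velocity_unit_of_lerayLocalStrongH1_of_apriori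
    (hLoc : leray_local_strong_H1) (hA : tao2011_enstrophyLocalisation_exterior_apriori) :
    tao_unconditional_uniqueness_velocity_unit :=
  tao_unconditional_uniqueness_velocity_iff_unit.1
    (tao_unconditional_uniqueness_velocity_of_boundedEnstrophy
      (tao2011_boundedEnstrophy_of_lerayLocalStrongH1_of_apriori hLoc hA))

end Literature.Analysis.FluidPDE

end
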